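import Summits.Ventures.Crystal3D.Bulk.GapKiteHoleCorner
import Summits.Ventures.Crystal3D.Bulk.GapKite
import Mathlib.Geometry.Euclidean.Angle.Unoriented.TriangleInequality
import HarnessLib

/-!
# Single-corner UPPER rows of the P-kite: far corner `≤ 2 A_x(ρ)`, side corner `≤ A_x(ρ) + α₀`,
# and two «R-max» rows behind them — for every admissible configuration, no convexity

HONEST FRAMING. Part of the venture `Summits/Ventures/Crystal3D` (cell `pub-crystal3d`, phase 2;
seat p2, PROMOTION-AUDIT prep, memo r1.1 A6 (b1): the B-lineage's hole-quadrilateral tables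
`PZ4_I` ae9e4206 / `PZ4_W1` c7ab06e7). Kernel theorems about an ADMISSIBLE fourteen-ball
configuration `c` (`IsGapConfig c`; no extremality, NO convexity / face hypothesis); nothing here
asserts anything about GAP(1.26), books or replays a kill, or moves a census number.

The P-KITE `(p, a, b, e)` of the tight graph — the intruder `p` tight to the shell balls `a ≠ e`, a
shell ball `b` tight to `a` and `e`, sides `(ρ, 60°, 60°, ρ)` — is the polygon of the `PZ4` tables
(`A₂ = p`, `A₁ = a`, `A₃ = e`, `A₄ = b`; corners `u₂ = corner c 13 a e`, `u₁ = corner c a 13 b`,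
`u₃ = corner c e 13 b`, `u₄ = corner c b a e`). The tree already has the LOWER single-corner rows
`u₁, u₃ ≥ A_x(D)` (`IsGapConfig.arccos_Ax_le_corner`), `u₂ ≥ A_p(D)` (`arccos_Ap_le_corner`),
`u₄ ≥ α₀ = arccos (1/3)` (`arccos_third_le_corner`), the symmetry `u₁ = u₃` (`kite_corner_eq`) and
ONE upper row `u₂ ≤ 2 A_p(D)` (`hole_corner_kite_le`). THIS file adds the two missing UPPER rows, with
`A_x(D) = arccos (D/(√3 √(4 − D²)))`, `D = intruderDist c = 2 cos ρ`, `D² ≤ 2`: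

* **`IsGapConfig.far_corner_kite_le`**: `u₄ = corner c b a e ≤ 2 · A_x(D)` (equality iff `|pb| = ρ`)
  — the twin of `hole_corner_kite_le`: `cos u₄ = (4⟪u_a,u_e⟫ − 1)/3` (`cos_corner_rhombus`) and
  `⟪u_a,u_e⟫ ≥ −cos A_p(D)` (`inner_gapDir_ge_of_kite`) give `cos u₄ ≥ cos (2A_x)` exactly;
* **`IsGapConfig.side_corner_kite_le`**: `u₁ = corner c a 13 b ≤ A_x(D) + arccos (1/3)` — by the
  triangle inequality for angles at `u_a` (Mathlib `InnerProductGeometry.angle_le_angle_add_angle`)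
  from the two general «R-max» rows below (in the CONVEX kite `u₁ = β + γ` with L3P's
  `cos β = cot ρ tan (d/2)`, `cos γ = tan (d/2)/√3`; the tree proves only `≤`, which needs no
  convexity);
* **`IsGapConfig.corner_hole_shell_le_Ax`** (R-max, first kind): at a shell ball `a` touching the
  intruder, the corner between the hole `p` and ANY other shell ball `e` touching the intruder is
  `≤ A_x(D)` (equality iff `a, e` touch: `corner_eq_arccos_Ax`) — two-level tangent formula with
  `⟪u_a, u_e⟫ ≤ 1/2`;
* **`IsGapConfig.corner_shell_shell_le_third`** (R-max, second kind): at a shell ball `a` touching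
  the shell ball `b`, the corner between `b` and ANY other shell ball `e` touching `b` is `≤ α₀`
  (equality iff `a, e` touch: `corner_eq_arccos_third`).

With these, every corner of a P-kite lies in a kernel box per `D`:
`u₁ = u₃ ∈ [A_x, A_x + α₀]`, `u₂ ∈ [A_p, 2A_p]`, `u₄ ∈ [α₀, 2A_x]`; the `PZ4` rows whose printed
functional is sign-monotone along the kite family follow by `linarith` from the box and endpoint
literals (companion file, p2). The other `PZ4` rows (interior maxima in the kite parameter) are NOT
claimed here.
-/

noncomputable section

open scoped BigOperators InnerProductSpace
open Finset Real

namespace Summit.Ventures.Crystal3D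

open Literature.Geometry.DiscreteGeometry InnerProductGeometry

/-! ## §1 Two real inequalities (the cosine comparisons) -/

/-- For `−1 < G ≤ 1/2`: `1/3 ≤ (1/2 − G·(1/2)) / (√(1 − G²) · √(1 − (1/2)²))`, i.e.
`(1 − G)/(√3 √(1 − G²)) ≥ 1/3` (`⟺ 3(1 − G) ≥ 1 + G`). [folklore] -/
theorem third_le_corner_cos_aux {G : ℝ} (hG1 : -1 < G) (hG : G ≤ 1 / 2) :
    (1 : ℝ) / 3 ≤ (1 / 2 - G * (1 / 2)) / (√(1 - G ^ 2) * √(1 - (1 / 2 : ℝ) ^ 2)) := by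
  have h1G : 0 < 1 - G ^ 2 := by nlinarith
  have hs : 0 < √(1 - G ^ 2) := Real.sqrt_pos.2 h1G
  rw [sqrt_one_sub_half_sq]
  have hs3 : 0 < √3 := Real.sqrt_pos.2 (by norm_num)
  rw [div_le_div_iff₀ (by norm_num) (by positivity)]
  -- `1 * (√(1−G²) * (√3/2)) ≤ (1/2 − G/2) * 3`
  have hkey : √(1 - G ^ 2) * √3 ≤ 3 * (1 - G) := by
    rw [← Real.sqrt_mul h1G.le]
    have h3 : (3 : ℝ) * (1 - G) = √((3 * (1 - G)) ^ 2) := by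
      rw [Real.sqrt_sq (by linarith)]
    rw [h3]
    exact Real.sqrt_le_sqrt (by nlinarith)
  nlinarith

/-- For `0 < D`, `D² < 4`, `−1 < G ≤ 1/2`:
`D/(√3 √(4 − D²)) ≤ (D/2 − (D/2)·G) / (√(1 − (D/2)²) · √(1 − G²))`, i.e.
`cos A_x(D) ≤ cot ρ · tan (|ae|/2)` for `|ae| ≥ 60°`. [folklore] -/
theorem cosAx_le_corner_cos_aux {D G : ℝ} (hD0 : 0 < D) (hD4 : D ^ 2 < 4) (hG1 : -1 < G)
    (hG : G ≤ 1 / 2) :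
    D / (√3 * √(4 - D ^ 2)) ≤ (D / 2 - D / 2 * G) / (√(1 - (D / 2) ^ 2) * √(1 - G ^ 2)) := by
  have h1G : 0 < 1 - G ^ 2 := by nlinarith
  have hs : 0 < √(1 - G ^ 2) := Real.sqrt_pos.2 h1G
  have hs3 : 0 < √3 := Real.sqrt_pos.2 (by norm_num)
  have h4 : 0 < 4 - D ^ 2 := by linarith
  have hs4 : 0 < √(4 - D ^ 2) := Real.sqrt_pos.2 h4
  rw [sqrt_one_sub_half_mul_sq, div_le_div_iff₀ (by positivity) (by positivity)]
  -- `D * (√(4−D²)/2 * √(1−G²)) ≤ (D/2 − D/2·G) * (√3 * √(4−D²))`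
  have hkey : √(1 - G ^ 2) ≤ (1 - G) * √3 := by
    have h3 : (1 - G) * √3 = √(((1 - G)) ^ 2 * 3) := by
      rw [Real.sqrt_mul (sq_nonneg _), Real.sqrt_sq (by linarith)]
    rw [h3]
    exact Real.sqrt_le_sqrt (by nlinarith)
  have e1 : D * (√(4 - D ^ 2) / 2 * √(1 - G ^ 2)) = (D / 2 * √(4 - D ^ 2)) * √(1 - G ^ 2) := by
    ring
  have e2 : (D / 2 - D / 2 * G) * (√3 * √(4 - D ^ 2)) =
      (D / 2 * √(4 - D ^ 2)) * ((1 - G) * √3) := by ring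
  rw [e1, e2]
  exact mul_le_mul_of_nonneg_left hkey (by positivity)

/-! ## §2 The rows -/

section Config

variable {c : Fin 14 → EuclideanSpace ℝ (Fin 3)}

/-- Two shell directions at the same positive level from a third direction are not antipodal:
if `⟪u_a, w⟫ = ⟪u_e, w⟫ = κ` with `κ ≠ 0` and `u_a, u_e` unit, then `−1 < ⟪u_a, u_e⟫`. [folklore] -/
theorem neg_one_lt_inner_of_level {F : Type*} [NormedAddCommGroup F] [InnerProductSpace ℝ F]
    {a e w : F} (ha : ‖a‖ = 1) (he : ‖e‖ = 1) {κ : ℝ} (hκ : κ ≠ 0) (haw : ⟪a, w⟫_ℝ = κ)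
    (hew : ⟪e, w⟫_ℝ = κ) : -1 < ⟪a, e⟫_ℝ := by
  by_contra h
  push Not at h
  have haa : ⟪a, a⟫_ℝ = 1 := by rw [real_inner_self_eq_norm_sq, ha, one_pow]
  have hee : ⟪e, e⟫_ℝ = 1 := by rw [real_inner_self_eq_norm_sq, he, one_pow]
  have hea : ⟪e, a⟫_ℝ = ⟪a, e⟫_ℝ := real_inner_comm _ _
  have hsum : ‖a + e‖ ^ 2 = 2 + 2 * ⟪a, e⟫_ℝ := by
    rw [← real_inner_self_eq_norm_sq, inner_add_left, inner_add_right, inner_add_right, haa, hee,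
      hea]
    ring
  have h0 : ‖a + e‖ ^ 2 = 0 := le_antisymm (by rw [hsum]; linarith) (sq_nonneg _)
  have h0' : a + e = 0 := by
    rw [sq_eq_zero_iff, norm_eq_zero] at h0
    exact h0
  have he' : e = -a := eq_neg_of_add_eq_zero_right h0'
  rw [he', inner_neg_left, haw] at hew
  exact hκ (by linarith)

/-- **R-max row (first kind): at a shell ball touching the intruder, the corner between the hole
and any other hole contact is at most `A_x(D)`.** For an admissible configuration with `D < 2`,
shell balls `a ≠ e` both touching the intruder: `corner c a 13 e ≤ arccos (D/(√3 √(4 − D²)))`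
(equality iff `a, e` touch, `corner_eq_arccos_Ax`; only the pair row `⟪u_a, u_e⟫ ≤ 1/2` is used).
[folklore] -/
theorem IsGapConfig.corner_hole_shell_le_Ax (hc : IsGapConfig c) (hD : intruderDist c < 2)
    {a e : Fin 14} (ha0 : a ≠ 0) (ha13 : a ≠ 13) (he0 : e ≠ 0) (he13 : e ≠ 13) (hae : a ≠ e)
    (ha : dist (c a) (c 13) = 1) (he : dist (c e) (c 13) = 1) :
    corner c a 13 e ≤ Real.arccos (intruderDist c / (√3 * √(4 - intruderDist c ^ 2))) := by
  set D := intruderDist c with hDdef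
  have hD1 : 1 ≤ D := hc.one_le_intruderDist
  have h13 : (13 : Fin 14) ≠ 0 := by decide
  have hap : ⟪gapDir c a, gapDir c 13⟫_ℝ = D / 2 := by
    rw [hc.inner_gapDir_eq ha0 h13 ha, tightLevel_of_right]
  have hep : ⟪gapDir c e, gapDir c 13⟫_ℝ = D / 2 := by
    rw [hc.inner_gapDir_eq he0 h13 he, tightLevel_of_right]
  have hpe : ⟪gapDir c 13, gapDir c e⟫_ℝ = D / 2 := by rw [real_inner_comm]; exact hep
  have hG : ⟪gapDir c a, gapDir c e⟫_ℝ ≤ 1 / 2 := by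
    have h := hc.inner_gapDir_le ha0 he0 hae
    rw [tightLevel_of_ne ha13 he13] at h
    exact h
  have hG1 : -1 < ⟪gapDir c a, gapDir c e⟫_ℝ :=
    neg_one_lt_inner_of_level (hc.norm_gapDir ha0) (hc.norm_gapDir he0) (by linarith : D / 2 ≠ 0)
      hap hep
  unfold corner
  rw [angle_tangentProj_eq_arccos (hc.norm_gapDir ha0) (hc.norm_gapDir h13) (hc.norm_gapDir he0)
    hap rfl hpe]
  apply Real.arccos_le_arccos
  exact cosAx_le_corner_cos_aux (by linarith) (by nlinarith) hG1 hG

/-- **R-max row (second kind): at a shell ball touching the shell ball `b`, the corner between `b`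
and any other shell contact `e` of `b` is at most `α₀ = arccos (1/3)`.** For an admissible
configuration, shell balls `a ≠ e` both touching the shell ball `b`: `corner c a e b ≤ arccos (1/3)`
(equality iff `a, e` touch, `corner_eq_arccos_third`). [folklore] -/
theorem IsGapConfig.corner_shell_shell_le_third (hc : IsGapConfig c) {a e b : Fin 14} (ha0 : a ≠ 0)
    (ha13 : a ≠ 13) (he0 : e ≠ 0) (he13 : e ≠ 13) (hb0 : b ≠ 0) (hb13 : b ≠ 13) (hae : a ≠ e)
    (hab : dist (c a) (c b) = 1) (heb : dist (c e) (c b) = 1) :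
    corner c a e b ≤ Real.arccos (1 / 3) := by
  have hab' : ⟪gapDir c a, gapDir c b⟫_ℝ = 1 / 2 := by
    rw [hc.inner_gapDir_eq ha0 hb0 hab, tightLevel_of_ne ha13 hb13]
  have heb' : ⟪gapDir c e, gapDir c b⟫_ℝ = 1 / 2 := by
    rw [hc.inner_gapDir_eq he0 hb0 heb, tightLevel_of_ne he13 hb13]
  have hG : ⟪gapDir c a, gapDir c e⟫_ℝ ≤ 1 / 2 := by
    have h := hc.inner_gapDir_le ha0 he0 hae
    rw [tightLevel_of_ne ha13 he13] at h
    exact h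
  have hG1 : -1 < ⟪gapDir c a, gapDir c e⟫_ℝ :=
    neg_one_lt_inner_of_level (hc.norm_gapDir ha0) (hc.norm_gapDir he0) (by norm_num) hab' heb'
  unfold corner
  rw [angle_tangentProj_eq_arccos (hc.norm_gapDir ha0) (hc.norm_gapDir he0) (hc.norm_gapDir hb0)
    rfl hab' heb']
  apply Real.arccos_le_arccos
  exact third_le_corner_cos_aux hG1 hG

/-- **The side corner of a P-kite is at most `A_x(D) + α₀`** (L3P-METHOD §2 (K) «`u_a = u_c = β + γ`»
as an inequality, for EVERY admissible configuration): for shell balls `a ≠ e` touching the intruder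
and a shell ball `b` touching `a` and `e`, with `D < 2`:
`corner c a 13 b ≤ arccos (D/(√3 √(4 − D²))) + arccos (1/3)`. (Triangle inequality for the angles
at `u_a` towards `p̂`, `u_e`, `u_b`, and the two R-max rows.) [folklore] -/
theorem IsGapConfig.side_corner_kite_le (hc : IsGapConfig c) (hD : intruderDist c < 2)
    {a e b : Fin 14} (ha0 : a ≠ 0) (ha13 : a ≠ 13) (he0 : e ≠ 0) (he13 : e ≠ 13) (hb0 : b ≠ 0)
    (hb13 : b ≠ 13) (hae : a ≠ e) (ha : dist (c a) (c 13) = 1) (he : dist (c e) (c 13) = 1)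
    (hba : dist (c b) (c a) = 1) (hbe : dist (c b) (c e) = 1) :
    corner c a 13 b ≤
      Real.arccos (intruderDist c / (√3 * √(4 - intruderDist c ^ 2))) + Real.arccos (1 / 3) := by
  have h1 := hc.corner_hole_shell_le_Ax hD ha0 ha13 he0 he13 hae ha he
  have h2 := hc.corner_shell_shell_le_third ha0 ha13 he0 he13 hb0 hb13 hae
    (by rw [dist_comm]; exact hba) (by rw [dist_comm]; exact hbe)
  have hsub : corner c a 13 b ≤ corner c a 13 e + corner c a e b :=
    InnerProductGeometry.angle_le_angle_add_angle _ _ _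
  linarith

/-- **The far corner of a P-kite is at most `2 A_x(D)`** (twin of `hole_corner_kite_le`; equality
iff `|pb| = ρ`): for an admissible configuration with `D² ≤ 2`, shell balls `a, e` touching the
intruder and a shell ball `b` touching `a` and `e`:
`corner c b a e ≤ 2 · arccos (D/(√3 √(4 − D²)))`. Proof: `cos (corner c b a e) = (4⟪u_a,u_e⟫ − 1)/3`
(`cos_corner_rhombus`), `⟪u_a, u_e⟫ ≥ −(2 − D²)/(4 − D²)` (`inner_gapDir_ge_of_kite`, pair rows
only), and `(−4(2 − D²)/(4 − D²) − 1)/3 = 2cos² A_x − 1 = cos (2A_x)`. [folklore] -/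
theorem IsGapConfig.far_corner_kite_le (hc : IsGapConfig c) (hD2 : intruderDist c ^ 2 ≤ 2)
    {a e b : Fin 14} (ha0 : a ≠ 0) (ha13 : a ≠ 13) (he0 : e ≠ 0) (he13 : e ≠ 13) (hb0 : b ≠ 0)
    (hb13 : b ≠ 13) (ha : dist (c a) (c 13) = 1) (he : dist (c e) (c 13) = 1)
    (hba : dist (c b) (c a) = 1) (hbe : dist (c b) (c e) = 1) :
    corner c b a e ≤ 2 * Real.arccos (intruderDist c / (√3 * √(4 - intruderDist c ^ 2))) := by
  set D := intruderDist c with hDdef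
  have hD1 : 1 ≤ D := hc.one_le_intruderDist
  have h4 : 0 < 4 - D ^ 2 := by nlinarith
  have hs3 : 0 < √3 := Real.sqrt_pos.2 (by norm_num)
  have hs4 : 0 < √(4 - D ^ 2) := Real.sqrt_pos.2 h4
  set w := D / (√3 * √(4 - D ^ 2)) with hw
  have hw0 : 0 ≤ w := div_nonneg (by linarith) (mul_pos hs3 hs4).le
  have hw2 : w ^ 2 = D ^ 2 / (3 * (4 - D ^ 2)) := by
    rw [hw, div_pow, mul_pow, Real.sq_sqrt (by norm_num : (0:ℝ) ≤ 3), Real.sq_sqrt h4.le]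
  have hw1 : w ≤ 1 := by
    have h : w ^ 2 ≤ 1 := by
      rw [hw2, div_le_one (by positivity)]
      nlinarith
    nlinarith [hw0]
  have hG := hc.inner_gapDir_ge_of_kite hD2 ha0 ha13 he0 he13 hb0 hb13 ha he hba hbe
  have hcos := hc.cos_corner_rhombus hb0 hb13 ha0 ha13 he0 he13 hba hbe
  rw [← arccos_two_mul_sq_sub_one hw0 hw1]
  have h0 : 0 ≤ corner c b a e := InnerProductGeometry.angle_nonneg _ _
  have hπ : corner c b a e ≤ π := InnerProductGeometry.angle_le_pi _ _
  rw [← Real.arccos_cos h0 hπ]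
  apply Real.arccos_le_arccos
  rw [hcos, hw2]
  have heq : 2 * (D ^ 2 / (3 * (4 - D ^ 2))) - 1 = (4 * (-((2 - D ^ 2) / (4 - D ^ 2))) - 1) / 3 := by
    field_simp
    ring
  rw [heq]
  have h3 : (4 * (-((2 - D ^ 2) / (4 - D ^ 2))) - 1) / 3 ≤
      (4 * ⟪gapDir c a, gapDir c e⟫_ℝ - 1) / 3 := by
    apply div_le_div_of_nonneg_right _ (by norm_num : (0:ℝ) ≤ 3)
    linarith
  exact h3

/-- **The kernel box of a P-kite** (all six single-corner rows together, per `D` with `D² ≤ 2`):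
`A_x ≤ u₁ ≤ A_x + α₀`, `u₃ = u₁`, `A_p ≤ u₂ ≤ 2A_p`, `α₀ ≤ u₄ ≤ 2A_x` for the corners
`u₁ = corner c a 13 b`, `u₃ = corner c e 13 b`, `u₂ = corner c 13 a e`, `u₄ = corner c b a e`. -/
theorem IsGapConfig.kite_corner_box (hc : IsGapConfig c) (hD2 : intruderDist c ^ 2 ≤ 2)
    {a e b : Fin 14} (ha0 : a ≠ 0) (ha13 : a ≠ 13) (he0 : e ≠ 0) (he13 : e ≠ 13) (hb0 : b ≠ 0)
    (hb13 : b ≠ 13) (hae : a ≠ e) (ha : dist (c a) (c 13) = 1) (he : dist (c e) (c 13) = 1)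
    (hba : dist (c b) (c a) = 1) (hbe : dist (c b) (c e) = 1) :
    Real.arccos (intruderDist c / (√3 * √(4 - intruderDist c ^ 2))) ≤ corner c a 13 b ∧
    corner c a 13 b ≤
      Real.arccos (intruderDist c / (√3 * √(4 - intruderDist c ^ 2))) + Real.arccos (1 / 3) ∧
    corner c e 13 b = corner c a 13 b ∧
    Real.arccos ((2 - intruderDist c ^ 2) / (4 - intruderDist c ^ 2)) ≤ corner c 13 a e ∧
    corner c 13 a e ≤ 2 * Real.arccos ((2 - intruderDist c ^ 2) / (4 - intruderDist c ^ 2)) ∧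
    Real.arccos (1 / 3) ≤ corner c b a e ∧
    corner c b a e ≤ 2 * Real.arccos (intruderDist c / (√3 * √(4 - intruderDist c ^ 2))) := by
  have hD1 : 1 ≤ intruderDist c := hc.one_le_intruderDist
  have hD : intruderDist c < 2 := by nlinarith
  refine ⟨?_, ?_, ?_, ?_, ?_, ?_, ?_⟩
  · have h := hc.arccos_Ax_le_corner hD ha0 ha13 hb0 hb13 (by rw [dist_comm]; exact hba) ha
    rw [corner_comm] at h
    exact h
  · exact hc.side_corner_kite_le hD ha0 ha13 he0 he13 hb0 hb13 hae ha he hba hbe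
  · have h := hc.kite_corner_eq ha0 ha13 he0 he13 hb0 hb13 (by rw [dist_comm]; exact hba)
      (by rw [dist_comm]; exact hbe) ha he
    rw [corner_comm c a, corner_comm c e] at h
    exact h.symm
  · exact hc.arccos_Ap_le_corner hD ha0 ha13 he0 he13 ha he hae
  · exact hc.hole_corner_kite_le hD2 ha0 ha13 he0 he13 hb0 hb13 ha he hba hbe
  · exact hc.arccos_third_le_corner hb0 hb13 ha0 ha13 he0 he13 hba hbe hae
  · exact hc.far_corner_kite_le hD2 ha0 ha13 he0 he13 hb0 hb13 ha he hba hbe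

end Config

end Summit.Ventures.Crystal3D

end
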